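import Mathlib
import HarnessLib
import Summits.RiemannHypothesis.RiemannHypothesis.Theses.WeilParity
import Summits.RiemannHypothesis.RiemannHypothesis.Theses.GroundBarta
import Summits.RiemannHypothesis.RiemannHypothesis.Theorems.WeilParityEvenWinsBeyondArchSplit
import Summits.RiemannHypothesis.RiemannHypothesis.Theorems.WeilParityEvenWinsBeyondArchFrontier63
import Summits.RiemannHypothesis.RiemannHypothesis.Theorems.WeilGroundStateGroundStateSimpleEvenCellTransfer
import Summits.RiemannHypothesis.RiemannHypothesis.Theorems.WeilGroundStateGroundStateSimpleEvenTwoPrimeWindows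
import Summits.RiemannHypothesis.RiemannHypothesis.Theorems.WeilGroundStateGroundStateSimpleEvenOfNoParityCrossing
import Summits.RiemannHypothesis.RiemannHypothesis.Theorems.WeilParityEvenWinsBeyondArchFrontier65
import Summits.RiemannHypothesis.RiemannHypothesis.Theorems.WeilGroundStateGroundStateSimpleEvenTrialUpperK
import Summits.RiemannHypothesis.RiemannHypothesis.Theorems.WeilGroundStateGroundStateSimpleEvenOddLowerK67

/-!
# Cruxes `NoParityCrossing` (stmt-RiemannHypothesis-18085), `GroundStateSimpleEven` (stmt-RiemannHypothesis-1526) and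
# `EvenWinsBeyondArch` (stmt-RiemannHypothesis-15432; GroundBarta rung 4 = stmt-RiemannHypothesis-18807):
# the RH-free frontier moves from `13/20` to `2/3`

Support file.  Cell `K = [13/20, 2/3]` of the `{2,3}`-window ladder (item 18085, stub `stub_twoThreeWindowSimpleEven`) is
closed RH-free by the landed cell transfer `GroundStateSimpleEven.weilWindowSimpleEven_on_cell_of_le` from

* the U-side `trialUpperK : ε(13/20) ≤ 9/200000000000` (exact-rational Rayleigh–Ritz, landed), and
* the L-side `oddLowerK67 : Re Q(g) ≥ 1/2000000000` for odd normalised `g` on `[-2/3, 2/3]` (the kernel-checked two-prime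
  odd-sector margin certificate `weilCert23K` at `N = 177`, `Literature/…/WeilTwoPrimeOddMarginK*.lean`),

`9/200000000000 < 1/2000000000`, on top of the frontier `13/20` (`…Frontier65.lean`).  Consequences: `WeilWindowSimpleEven a`
and the strict parity order `ε_ev(a) < ε_od(a)` on EVERY window `0 < a ≤ 2/3`; item 18085 ↔ "no parity tie beyond `2/3`";
`GroundStateSimpleEven` ↔ the same; `EvenWinsBeyondArch` (WeilParity and the GroundBarta copy) from "no tie beyond `2/3`".  The last
cell `H = [2/3, log 2]` has its U-side landed (`trialUpperH : ε(2/3) ≤ 1/100000000000`); its L-side (an odd-sector margin `> 10⁻¹¹`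
on `[-log 2, log 2]`) is NOT reachable with the `T = 80` minorant (the minorant form's odd bottom at `a₀ = 6932/10000` is `≈ −1.3·10⁻¹⁰`
even with perfect cells; it needs `T ≈ 120`, `N ≈ 260` and cells about ten times tighter on `[0, 30]` — FEASIBILITY-K.md on item 18085).
Mathlib + landed tree files only; no definitions, no named facts, no `sorry`.
-/

noncomputable section

open Set MeasureTheory

-- D-0017: single-problem summit ⇒ namespace `Summit.RiemannHypothesis.RiemannHypothesis.…` by design.
set_option linter.dupNamespace false

namespace Summit.RiemannHypothesis.RiemannHypothesis.Theorems.EvenWinsBeyondArch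

open Literature.NumberTheory.LFunctions
open Summit.RiemannHypothesis.RiemannHypothesis.Theses.WeilParity
open Summit.RiemannHypothesis.RiemannHypothesis.Theses.WeilGroundState

/-! ## Cell `K = [13/20, 2/3]` and the clause up to `2/3` -/

/-- **Cell `K`**: `WeilWindowSimpleEven a` for every `13/20 ≤ a ≤ 2/3` (cell transfer with `U = 9/(2·10¹¹) < L = 1/(2·10⁹)`). [folklore] -/
theorem weilWindowSimpleEven_on_cell_K {a : ℝ} (hlo : (13 / 20 : ℝ) ≤ a) (hhi : a ≤ 2 / 3) :
    WeilWindowSimpleEven a :=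
  GroundStateSimpleEven.weilWindowSimpleEven_on_cell_of_le (b := 13 / 20) (c := 2 / 3)
    (U := 9 / 200000000000) (L := 1 / 2000000000) (by norm_num) (by norm_num)
    Summit.RiemannHypothesis.RiemannHypothesis.Theorems.trialUpperK
    Summit.RiemannHypothesis.RiemannHypothesis.Theorems.oddLowerK67 hlo hhi

/-- **The Connes–van Suijlekom hypothesis on every window `0 < a ≤ 2/3` (RH-free)**: up to `13/20` (`weilWindowSimpleEven_of_le_13_20`)
and the new cell `K`. [folklore] -/
theorem weilWindowSimpleEven_of_le_two_thirds : ∀ a : ℝ, 0 < a → a ≤ 2 / 3 → WeilWindowSimpleEven a := by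
  intro a ha hhi
  rcases le_or_gt a (13 / 20) with hle | hlt
  · exact weilWindowSimpleEven_of_le_13_20 a ha hle
  · exact weilWindowSimpleEven_on_cell_K hlt.le hhi

/-- **Strict parity order up to `2/3`**: `ε_ev(a) < ε_od(a)` for `0 < a ≤ 2/3`. RH-free. [folklore] -/
theorem weilEvenGroundEnergy_lt_weilOddGroundEnergy_of_le_two_thirds {a : ℝ} (ha : 0 < a) (hhi : a ≤ 2 / 3) :
    weilEvenGroundEnergy a < weilOddGroundEnergy a :=
  (weilWindowSimpleEven_iff_weilEvenGroundEnergy_lt ha).1 (weilWindowSimpleEven_of_le_two_thirds a ha hhi)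

/-- **Every ground state at every window `0 < a ≤ 2/3` is a.e. even.** [folklore] -/
theorem groundStates_ae_even_of_le_two_thirds :
    ∀ a : ℝ, 0 < a → a ≤ 2 / 3 → ∀ u : ℝ → ℂ, IsWeilGroundState a u → u =ᵐ[volume] fun t ↦ u (-t) :=
  fun a ha hhi ↦ (GroundStateSimpleEven.weilWindowSimpleEven_iff_groundStates_ae_even ha).1
    (weilWindowSimpleEven_of_le_two_thirds a ha hhi)

/-! ## The residues after cell `K`: no parity tie beyond `2/3` -/

/-- **No tie beyond `2/3` ⟹ `NoParityCrossing`** (item stmt-RiemannHypothesis-18085). [folklore] -/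
theorem noParityCrossing_of_beyond_two_thirds
    (h : ∀ a : ℝ, 2 / 3 < a → weilEvenGroundEnergy a ≠ weilOddGroundEnergy a) : NoParityCrossing := by
  intro a ha
  rcases le_or_gt a (2 / 3) with hle | hlt
  · have ha0 : 0 < a := lt_trans (by positivity) ha
    exact ne_of_lt (weilEvenGroundEnergy_lt_weilOddGroundEnergy_of_le_two_thirds ha0 hle)
  · exact h a hlt

/-- **`NoParityCrossing` ⟹ no tie beyond `2/3`** (trivial restriction). [folklore] -/
theorem beyond_two_thirds_of_noParityCrossing (h : NoParityCrossing) :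
    ∀ a : ℝ, 2 / 3 < a → weilEvenGroundEnergy a ≠ weilOddGroundEnergy a := by
  intro a ha
  have hl3 := Real.log_three_lt_d9
  exact h a (by linarith)

/-- **Item 18085 after cell `K`: `NoParityCrossing` ↔ no parity tie beyond `2/3`.** [folklore] -/
theorem noParityCrossing_iff_beyond_two_thirds :
    NoParityCrossing ↔ ∀ a : ℝ, 2 / 3 < a → weilEvenGroundEnergy a ≠ weilOddGroundEnergy a :=
  ⟨beyond_two_thirds_of_noParityCrossing, noParityCrossing_of_beyond_two_thirds⟩

/-- **`GroundStateSimpleEven` (stmt-RiemannHypothesis-1526) ↔ no parity tie beyond `2/3`.** [folklore] -/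
theorem groundStateSimpleEven_iff_noParityCrossingBeyond_two_thirds :
    GroundStateSimpleEven ↔ ∀ a : ℝ, 2 / 3 < a → weilEvenGroundEnergy a ≠ weilOddGroundEnergy a :=
  GroundStateSimpleEven.groundStateSimpleEven_iff_noParityCrossing.trans noParityCrossing_iff_beyond_two_thirds

/-- **The crux `EvenWinsBeyondArch` from "no tie beyond `2/3`"** (landed split glue). [folklore] -/
theorem evenWinsBeyondArch_of_noTie_beyond_two_thirds
    (hne : ∀ a : ℝ, 2 / 3 < a → weilEvenGroundEnergy a ≠ weilOddGroundEnergy a) : EvenWinsBeyondArch :=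
  evenWinsBeyondArch_of_subs WeilParity.onePrimeWindowSimpleEven_proof (noParityCrossing_of_beyond_two_thirds hne)

/-- **What the crux still asserts**: `EvenWinsBeyondArch ↔ ∀ a > 2/3, ε_ev(a) ≤ ε_od(a)`. [folklore] -/
theorem evenWinsBeyondArch_iff_forall_le_beyond_two_thirds :
    EvenWinsBeyondArch ↔ ∀ a : ℝ, 2 / 3 < a → weilEvenGroundEnergy a ≤ weilOddGroundEnergy a := by
  rw [evenWinsBeyondArch_iff_forall_le]
  refine ⟨fun h a ha ↦ h a (lt_trans log_two_half_lt_63 (lt_trans (by norm_num) ha)), fun h a ha ↦ ?_⟩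
  rcases le_or_gt a (2 / 3) with hle | hlt
  · exact (weilEvenGroundEnergy_lt_weilOddGroundEnergy_of_le_two_thirds (log_two_half_pos.trans ha) hle).le
  · exact h a hlt

/-- **A failure of the crux forces an exact parity tie at some window `a > 2/3`.** [folklore] -/
theorem exists_tie_beyond_two_thirds_of_not_evenWinsBeyondArch (h : ¬ EvenWinsBeyondArch) :
    ∃ a : ℝ, 2 / 3 < a ∧ weilEvenGroundEnergy a = weilOddGroundEnergy a := by
  by_contra hne
  push Not at hne
  exact h (evenWinsBeyondArch_of_noTie_beyond_two_thirds hne)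

end Summit.RiemannHypothesis.RiemannHypothesis.Theorems.EvenWinsBeyondArch

/-! ## The route thesis on every window up to `2/3`, and the GroundBarta transport -/

namespace Summit.RiemannHypothesis.RiemannHypothesis.Theorems.WeilParity

open Literature.NumberTheory.LFunctions

/-- **The even sector wins on every window `0 < a ≤ 2/3`** (RH-free): every odd `L²`-normalised Weil test on `[-a, a]`
is matched up to any `δ > 0` by an even one. [folklore] -/
theorem evenSectorWins_upTo_twoThirds :
    ∀ a : ℝ, 0 < a → a ≤ 2 / 3 → ∀ o : ℝ → ℂ,
      Literature.NumberTheory.LFunctions.IsWeilTest o → tsupport o ⊆ Set.Icc (-a) a →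
      (∀ t, o (-t) = -o t) → ∫ t, ‖o t‖ ^ 2 = (1 : ℝ) → ∀ δ : ℝ, 0 < δ →
        ∃ e : ℝ → ℂ, Literature.NumberTheory.LFunctions.IsWeilTest e ∧ tsupport e ⊆ Set.Icc (-a) a ∧
          (∀ t, e (-t) = e t) ∧ ∫ t, ‖e t‖ ^ 2 = (1 : ℝ) ∧
          (Literature.NumberTheory.LFunctions.weilQuadratic e).re ≤
            (Literature.NumberTheory.LFunctions.weilQuadratic o).re + δ :=
  fun _ ha hle ↦ evenWinsAt_of_le ha
    (EvenWinsBeyondArch.weilEvenGroundEnergy_lt_weilOddGroundEnergy_of_le_two_thirds ha hle).le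

end Summit.RiemannHypothesis.RiemannHypothesis.Theorems.WeilParity

namespace Summit.RiemannHypothesis.RiemannHypothesis.Theorems.GroundBarta

open Literature.NumberTheory.LFunctions

/-- **GroundBarta's rung 4 from "no tie beyond `2/3`"** (transport along the `Iff.rfl` copy
`GroundBarta.evenWinsBeyondArch_iff_weilParity`). [folklore] -/
theorem evenWinsBeyondArch_of_noTie_beyond_two_thirds
    (hne : ∀ a : ℝ, 2 / 3 < a → weilEvenGroundEnergy a ≠ weilOddGroundEnergy a) :
    Summit.RiemannHypothesis.RiemannHypothesis.Theses.GroundBarta.EvenWinsBeyondArch :=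
  evenWinsBeyondArch_iff_weilParity.2 (EvenWinsBeyondArch.evenWinsBeyondArch_of_noTie_beyond_two_thirds hne)

/-- **What GroundBarta's rung 4 still asserts**: `↔ ∀ a > 2/3, ε_ev(a) ≤ ε_od(a)`. [folklore] -/
theorem evenWinsBeyondArch_iff_forall_le_beyond_two_thirds :
    Summit.RiemannHypothesis.RiemannHypothesis.Theses.GroundBarta.EvenWinsBeyondArch ↔
      ∀ a : ℝ, 2 / 3 < a → weilEvenGroundEnergy a ≤ weilOddGroundEnergy a :=
  evenWinsBeyondArch_iff_weilParity.trans EvenWinsBeyondArch.evenWinsBeyondArch_iff_forall_le_beyond_two_thirds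

end Summit.RiemannHypothesis.RiemannHypothesis.Theorems.GroundBarta

end
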